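import Summits.BirchSwinnertonDyer.BirchSwinnertonDyer.Theorems.KolyvaginRankRigidityAtTwoWalkFrameAlgebra
import Mathlib.Tactic.Module
import HarnessLib

/-!
# Crux U1 `KolyvaginBoundedDefectAtTwo` (stmt-BirchSwinnertonDyer-28083), LINE 17 `regular_core_rigidity`,
# stub S1b `stub_nearCoreExistenceAtTwo` — THE WALK, part 2a: algebra of the pure step and of conductors

Width seat `bsd-line-krr2-p2` g15 (ONE READER on S1b); `--supports stmt-BirchSwinnertonDyer-28083` (helper).
THEOREMS ONLY; nothing here proves S1b, U1, a rung or BSD. BSD is NOT proved.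

* `two_pow_sub_dvd_of_dvd_mul`, `two_pow_dvd_mul_of_sub_dvd` — exponent bookkeeping `2^a ∣ 2^D b ↔ 2^(a−D) ∣ b`;
* `pure_step_identity` — the `ℤ`-module identity behind (F3) of the pure step (`s = ±1`), proved by `module` in the
  coherent `galoisCohomology` spelling of `H¹(K, E[n])` and transported by definitional unfolding;
* `step_conductor` — adjoining a fresh prime `ℓ > c` to a square-free conductor: `cℓ` is square-free, `ℓ ∤ c`,
  `(cℓ).primeFactors = insert ℓ c.primeFactors`, and a prime-wise property propagates. [folklore]
Design: no definitions; `K : Type`; axioms `propext`, `Classical.choice`, `Quot.sound`.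
-/

set_option autoImplicit false
-- the Theorems namespace of this sub repeats the summit name by design (D-0017 nested layout)
set_option linter.dupNamespace false

noncomputable section

open scoped Classical
open Function NumberField WeierstrassCurve Field Finset
open Literature.NumberTheory.EllipticCurves Literature.NumberTheory.GaloisRepresentations

namespace Summit.BirchSwinnertonDyer.BirchSwinnertonDyer.Theorems.KolyvaginAtTwo.RegularWalk

variable {K : Type} [Field K] [NumberField K] (W : WeierstrassCurve ℚ)

/-! ### §1 Algebra helpers for the pure step -/

/-- `2^a ∣ 2^D b ⇒ 2^(a − D) ∣ b`. [folklore] -/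
theorem two_pow_sub_dvd_of_dvd_mul {a D : ℕ} {b : ℤ} (h : (2 : ℤ) ^ a ∣ 2 ^ D * b) : (2 : ℤ) ^ (a - D) ∣ b := by
  rcases le_or_gt a D with hle | hlt
  · rw [Nat.sub_eq_zero_of_le hle, pow_zero]; exact one_dvd b
  · have e : (2 : ℤ) ^ a = 2 ^ D * 2 ^ (a - D) := by rw [← pow_add]; congr 1; omega
    rw [e] at h
    exact (mul_dvd_mul_iff_left (pow_ne_zero D two_ne_zero)).mp h
/-- `2^(k − D) ∣ b ⇒ 2^k ∣ 2^D b`. [folklore] -/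
theorem two_pow_dvd_mul_of_sub_dvd {k D : ℕ} {b : ℤ} (h : (2 : ℤ) ^ (k - D) ∣ b) : (2 : ℤ) ^ k ∣ 2 ^ D * b :=
  (pow_dvd_pow 2 (by omega : k ≤ D + (k - D))).trans (by rw [pow_add]; exact mul_dvd_mul_left _ h)

/-- The pure-step identity (a `module` identity over `ℤ`, valid for `s = ±1`), in the coherent
`galoisCohomology` spelling of `H¹(K, E[n])`. [folklore] -/
theorem pure_step_identity (n : ℤ) (u r cr p Z : galoisCohomology ((W.baseChange K).torsionGaloisModule n) 1)
    (t s b₁ : ℤ) (hs : s = 1 ∨ s = -1) (J j : ℕ) :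
    ((2 : ℤ) ^ (J + 2 * j + 1)) • u - ((-(t * s * 2 ^ (J + 2 * j))) • (cr - s • r) + ((2 : ℤ) ^ j) • Z) =
      ((2 : ℤ) ^ j) • (((2 : ℤ) ^ J) • ((2 : ℤ) • (((2 : ℤ) ^ j) • (u - t • r)) + t • (((2 : ℤ) ^ j) • (r + s • cr))) -
        (b₁ • p + Z)) + ((2 : ℤ) ^ j * b₁) • p := by
  rcases hs with rfl | rfl
  · module
  · module


/-- **Adjoining a fresh prime to a square-free conductor.** [folklore] -/
theorem step_conductor {c ℓ : ℕ} (hc : Squarefree c) (hℓP : ℓ.Prime) (hcℓ : c < ℓ) {P : ℕ → Prop}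
    (hP : ∀ ℓ' ∈ c.primeFactors, P ℓ') (hPℓ : P ℓ) :
    ¬ ℓ ∣ c ∧ Squarefree (c * ℓ) ∧ ℓ ∈ (c * ℓ).primeFactors ∧ ∀ ℓ' ∈ (c * ℓ).primeFactors, P ℓ' := by
  have hℓc : ¬ ℓ ∣ c := fun h ↦ absurd hcℓ (not_lt.mpr (Nat.le_of_dvd (Nat.pos_of_ne_zero hc.ne_zero) h))
  have hpf : (c * ℓ).primeFactors = insert ℓ c.primeFactors := by
    rw [Nat.primeFactors_mul hc.ne_zero hℓP.ne_zero, hℓP.primeFactors, Finset.union_comm, ← Finset.insert_eq]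
  refine ⟨hℓc, Nat.squarefree_mul_iff.mpr ⟨((Nat.Prime.coprime_iff_not_dvd hℓP).mpr hℓc).symm, hc, hℓP.squarefree⟩,
    by rw [hpf]; exact Finset.mem_insert_self _ _, fun ℓ' h ↦ ?_⟩
  rw [hpf, Finset.mem_insert] at h
  rcases h with rfl | h
  · exact hPℓ
  · exact hP ℓ' h

end Summit.BirchSwinnertonDyer.BirchSwinnertonDyer.Theorems.KolyvaginAtTwo.RegularWalk

end
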